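import Summits.FinalStateConjecture.FinalStateConjecture.Theorems.PhaseMixingCaptureBulkKerrCaptureC2ReflectionConvergence
import Literature.Geometry.Lorentzian.HypersurfaceNaturality
import Literature.Geometry.Lorentzian.CauchyDevelopmentComap
import Literature.Geometry.Lorentzian.CauchyDevelopmentRestrict
import Literature.Geometry.Lorentzian.KerrDataEmbedding
import Literature.Geometry.Lorentzian.KerrDataSchwarzschildMetric
import Literature.Geometry.Lorentzian.InitialDataPullback
import Literature.Geometry.Lorentzian.IsometryProofs
import Literature.Geometry.Lorentzian.LeviCivitaProofs
import HarnessLib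

/-!
# Crux `PhaseMixingCapture.BulkKerrCaptureC2` (stmt-FinalStateConjecture-14985): SPIN REVERSAL — the Kerr datum of
# spin `−a` is the pull-back of the Kerr datum of spin `a` along the reflection of the slice

Support file for the crux `BulkKerrCaptureC2`, sequel of `…ReflectionKerrSchild` / `…ReflectionConvergence`.  The
spatial trace `L₃ (y₀, y₁, y₂) = (y₀, −y₁, y₂)` of the coordinate reflection `L` maps the Kerr–Schild slice
`Kerr.slice (−a) r₀ = {r(−a, (0, y)) > max r₀ 0}` onto `Kerr.slice a r₀` (`reflect₃_mem_slice_iff`), and the induced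
diffeomorphism `F` pulls the Kerr initial data set of spin `a` back to that of spin `−a`:

* §1 `exists_sliceReflect` (the diffeomorphism `F : Kerr.slice (−a) r₀ ≃ₜ Kerr.slice a r₀`, `F y = L₃ y`; it is
  smooth with differential `L₃` by `contMDiff_isom` / `mfderiv_isom_apply`), `coe_sliceReflect_symm`;
* §2 the Cartesian components of a pulled-back datum `F^* D`: `hFun_comap_sliceReflect`, `kFun_comap_sliceReflect`
  (`(F^* D).hFun y = (D.hFun (L₃ y))(L₃ ·, L₃ ·)`, junk values included: `δ(L₃ ·, L₃ ·) = δ`);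
* §3 `smoothMetric_neg_eq_comap` (`g_{M,−a} = L^* g_{M,a}` as metrics on the chart `Kerr.region (−a) r₀`),
  `sliceK_reflect` (**`k_{M,−a}(y)(v, w) = k_{M,a}(L₃ y)(L₃ v, L₃ w)`** — naturality of the second fundamental form under
  the local isometry `L`, `PseudoRiemannianMetric.secondFundamentalForm_comap`, and under the reparametrisation `F`,
  `secondFundamentalForm_comp_right`, with `L ∘ ι_{−a} = ι_a ∘ F` for the slice embeddings `ι(y) = (0, y)` and
  `L ν_{M,−a} = ν_{M,a} ∘ F` for the future unit normals, `reflect_sliceNormal`), and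
  **`comap_sliceReflect_kerrData`**: `F^* (Kerr.data M a r₀) = Kerr.data M (−a) r₀`.

Everything is proved; no definitions, no named facts.  References: B. O'Neill, *Semi-Riemannian geometry* (1983),
Ch. 3, Prop. 3.59 and Ch. 4, Lemma 4.4 (isometries preserve the connection; the shape tensor is a tensor); R. Bartnik,
J. Isenberg, *The constraint equations* (2004), §2 (diffeomorphism covariance of initial data); R. P. Kerr, A. Schild
(1965), §2; G. B. Cook, Living Rev. Relativ. 3 (2000) 5, §3.2.2 (the Kerr–Schild slice data).
-/

-- the doubled `FinalStateConjecture.FinalStateConjecture` path component trips dupNamespace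
set_option linter.dupNamespace false

noncomputable section

-- instance search through the nested operator type `E3 →L[ℝ] E3 →L[ℝ] ℝ` (as in the tree files)
set_option maxSynthPendingDepth 3

open Set Function Topology TopologicalSpace Bundle
open scoped Manifold ContDiff Topology
open Literature.Geometry.Lorentzian

namespace Summit.FinalStateConjecture.FinalStateConjecture.Theorems.BulkKerrCaptureC2.Reflection

variable {L : E4 ≃ₗᵢ[ℝ] E4} (hL : ∀ (x : E4) (i : Fin 4), L x i = if i = 2 then -x i else x i)
  {L₃ : E3 ≃ₗᵢ[ℝ] E3} (hL₃ : ∀ (y : E3) (i : Fin 3), L₃ y i = if i = 1 then -y i else y i)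

/-! ## §1 The reflection of the slice -/

section Slice

include hL hL₃ in
/-- **The reflection of the slice**: the spatial reflection `L₃` restricts to a homeomorphism
`F : Kerr.slice b r₀ ≃ₜ Kerr.slice a r₀` whenever `b = −a` (`reflect₃_mem_slice_iff`; its inverse is again `L₃`).  The
spins are kept as two variables tied by `b = −a` so that every statement below applies verbatim to the inverse
reflection `Kerr.slice a r₀ ≃ₜ Kerr.slice b r₀` (`a = −b`). [folklore] -/
theorem exists_sliceReflect {a b : ℝ} (hba : b = -a) (r₀ : ℝ) :
    ∃ F : Kerr.slice b r₀ ≃ₜ Kerr.slice a r₀, ∀ y, ((F y : Kerr.slice a r₀) : E3) = L₃ y := by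
  subst hba
  exact
    ⟨{ toFun := fun y ↦ ⟨L₃ y, (reflect₃_mem_slice_iff hL hL₃).2 y.2⟩
       invFun := fun z ↦ ⟨L₃ z, (reflect₃_mem_slice_iff' hL hL₃).2 z.2⟩
       left_inv := fun _ ↦ Subtype.ext (reflect₃_reflect₃ hL₃ _)
       right_inv := fun _ ↦ Subtype.ext (reflect₃_reflect₃ hL₃ _)
       continuous_toFun := (L₃.continuous.comp continuous_subtype_val).subtype_mk _
       continuous_invFun := (L₃.continuous.comp continuous_subtype_val).subtype_mk _ }, fun _ ↦ rfl⟩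

variable {a b r₀ : ℝ} {F : Kerr.slice b r₀ ≃ₜ Kerr.slice a r₀} (hF : ∀ y, ((F y : Kerr.slice a r₀) : E3) = L₃ y)
include hL₃ hF

/-- The inverse of the slice reflection is the same reflection in coordinates: `F⁻¹ z = L₃ z`. [folklore] -/
theorem coe_sliceReflect_symm (z : Kerr.slice a r₀) : ((F.symm z : Kerr.slice b r₀) : E3) = L₃ z := by
  have h := hF (F.symm z)
  rw [F.apply_symm_apply] at h
  rw [h, reflect₃_reflect₃ hL₃]

end Slice

/-! ## §2 The Cartesian components of a datum pulled back along the slice reflection -/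

section Components

variable {a b r₀ : ℝ} {F : Kerr.slice b r₀ ≃ₜ Kerr.slice a r₀} (hF : ∀ y, ((F y : Kerr.slice a r₀) : E3) = L₃ y)
  (hFc : ContMDiff (𝓡 3) (𝓡 3) (∞ + 1) F) (hFi : ∀ u, Injective (mfderiv (𝓡 3) (𝓡 3) F u))
  {Φ₃ : (E3 →L[ℝ] E3 →L[ℝ] ℝ) ≃ₗᵢ[ℝ] (E3 →L[ℝ] E3 →L[ℝ] ℝ)}
  (hΦ₃ : ∀ (A : E3 →L[ℝ] E3 →L[ℝ] ℝ) (v w : E3), Φ₃ A v w = A (L₃ v) (L₃ w))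
include hF

/-- The metric of `F^* D` at `y`: `h_{F y}(L₃ v, L₃ w)`. Bartnik–Isenberg 2004, §2. [cite: BartnikIsenberg2004, §2] -/
theorem comap_h_inner_sliceReflect (D : InitialDataSet 𝓘(ℝ, E3) (Kerr.slice a r₀)) (y : Kerr.slice b r₀)
    (v w : E3) : (D.comap F hFc hFi).h.inner y v w = D.h.inner (F y) (L₃ v) (L₃ w) := by
  rw [InitialDataSet.comap_h_inner]
  change D.h.inner (F y) (mfderiv 𝓘(ℝ, E3) 𝓘(ℝ, E3) F y v) (mfderiv 𝓘(ℝ, E3) 𝓘(ℝ, E3) F y w) = _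
  rw [mfderiv_isom_apply hF, mfderiv_isom_apply hF]

/-- The tensor `k` of `F^* D` at `y`: `k_{F y}(L₃ v, L₃ w)`. Bartnik–Isenberg 2004, §2. [cite: BartnikIsenberg2004, §2] -/
theorem comap_k_sliceReflect (D : InitialDataSet 𝓘(ℝ, E3) (Kerr.slice a r₀)) (y : Kerr.slice b r₀) (v w : E3) :
    (D.comap F hFc hFi).k y v w = D.k (F y) (L₃ v) (L₃ w) := by
  rw [InitialDataSet.comap_k]
  change D.k (F y) (mfderiv 𝓘(ℝ, E3) 𝓘(ℝ, E3) F y v) (mfderiv 𝓘(ℝ, E3) 𝓘(ℝ, E3) F y w) = _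
  rw [mfderiv_isom_apply hF, mfderiv_isom_apply hF]

include hL hL₃ hΦ₃

/-- **The metric components of `F^* D`**: `(F^* D).hFun y = (D.hFun (L₃ y))(L₃ ·, L₃ ·)` for EVERY `y ∈ ℝ³`, when
`b = −a` (on the slice by `comap_h_inner_sliceReflect`; off the slice both are the junk value `δ`, which is
`L₃`-invariant, `y ∈ Kerr.slice (−a) r₀ ↔ L₃ y ∈ Kerr.slice a r₀`). Bartnik–Isenberg 2004, §2. [cite: BartnikIsenberg2004, §2] -/
theorem hFun_comap_sliceReflect (hba : b = -a) (D : InitialDataSet 𝓘(ℝ, E3) (Kerr.slice a r₀)) (y : E3) :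
    (D.comap F hFc hFi).hFun y = Φ₃ (D.hFun (L₃ y)) := by
  subst hba
  refine ContinuousLinearMap.ext fun v ↦ ContinuousLinearMap.ext fun w ↦ ?_
  rw [hΦ₃]
  by_cases hy : y ∈ Kerr.slice (-a) r₀
  · have hly : L₃ y ∈ Kerr.slice a r₀ := (reflect₃_mem_slice_iff hL hL₃).2 hy
    have hFy : F ⟨y, hy⟩ = ⟨L₃ y, hly⟩ := Subtype.ext (hF _)
    rw [InitialDataSet.hFun_of_mem _ hy, InitialDataSet.hFun_of_mem _ hly]
    change (D.comap F hFc hFi).h.inner ⟨y, hy⟩ v w = D.h.inner ⟨L₃ y, hly⟩ (L₃ v) (L₃ w)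
    rw [comap_h_inner_sliceReflect hF hFc hFi, hFy]
  · have hly : L₃ y ∉ Kerr.slice a r₀ := fun h ↦ hy ((reflect₃_mem_slice_iff hL hL₃).1 h)
    rw [InitialDataSet.hFun_of_not_mem _ hy, InitialDataSet.hFun_of_not_mem _ hly, innerSL_apply_apply,
      innerSL_apply_apply, L₃.inner_map_map]

/-- **The components of `k` of `F^* D`**: `(F^* D).kFun y = (D.kFun (L₃ y))(L₃ ·, L₃ ·)` for every `y ∈ ℝ³`, when
`b = −a` (off the slice both vanish). Bartnik–Isenberg 2004, §2. [cite: BartnikIsenberg2004, §2] -/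
theorem kFun_comap_sliceReflect (hba : b = -a) (D : InitialDataSet 𝓘(ℝ, E3) (Kerr.slice a r₀)) (y : E3) :
    (D.comap F hFc hFi).kFun y = Φ₃ (D.kFun (L₃ y)) := by
  subst hba
  refine ContinuousLinearMap.ext fun v ↦ ContinuousLinearMap.ext fun w ↦ ?_
  rw [hΦ₃]
  by_cases hy : y ∈ Kerr.slice (-a) r₀
  · have hly : L₃ y ∈ Kerr.slice a r₀ := (reflect₃_mem_slice_iff hL hL₃).2 hy
    have hFy : F ⟨y, hy⟩ = ⟨L₃ y, hly⟩ := Subtype.ext (hF _)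
    rw [InitialDataSet.kFun_of_mem _ hy, InitialDataSet.kFun_of_mem _ hly]
    change (D.comap F hFc hFi).k ⟨y, hy⟩ v w = D.k ⟨L₃ y, hly⟩ (L₃ v) (L₃ w)
    rw [comap_k_sliceReflect hF hFc hFi, hFy]
  · have hly : L₃ y ∉ Kerr.slice a r₀ := fun h ↦ hy ((reflect₃_mem_slice_iff hL hL₃).1 h)
    rw [InitialDataSet.kFun_of_not_mem _ hy, InitialDataSet.kFun_of_not_mem _ hly]
    rfl

end Components

/-! ## §3 The Kerr datum of spin `−a` is the pull-back of the Kerr datum of spin `a` -/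

section KerrData

/-- Congruence of the second fundamental form in the pair (map, normal field), on a chart domain `V ⊆ ℝ⁴` (the tangent
spaces are all `ℝ⁴`, so normal fields along equal maps can be compared pointwise). [folklore] -/
theorem secondFundamentalForm_congr_map' {V : Opens E4}
    {g : PseudoRiemannianMetric 𝓘(ℝ, E4) ∞ E4 (TangentSpace 𝓘(ℝ, E4) : V → Type _)} [g.HasLeviCivita]
    {P : Type*} [TopologicalSpace P] [ChartedSpace E3 P] {f₁ f₂ : P → V} (hf : f₁ = f₂)
    {ν₁ : NormalField 𝓘(ℝ, E4) f₁} {ν₂ : NormalField 𝓘(ℝ, E4) f₂} (hν : ∀ u, ν₁ u = ν₂ u) (u : P) :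
    g.secondFundamentalForm 𝓘(ℝ, E3) f₁ ν₁ u = g.secondFundamentalForm 𝓘(ℝ, E3) f₂ ν₂ u := by
  subst hf
  obtain rfl : ν₁ = ν₂ := funext hν
  rfl

variable [Kerr.Facts]
include hL

/-- **`g_{M,−a} = L^* g_{M,a}` as metrics on the chart `Kerr.region (−a) r₀`**: for the chart reflection
`R : Kerr.region (−a) r₀ → Kerr.region a r₀`, `R x = L x` (smooth with injective differential `L`), the smooth Kerr
metric of spin `−a` IS the pull-back (`PseudoRiemannianMetric.comap`) of the smooth Kerr metric of spin `a`
(`bilin_reflect`, pointwise). Kerr–Schild 1965, §2; O'Neill 1983, Ch. 3, pp. 90–91. [cite: KerrSchild1965, §2] -/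
theorem smoothMetric_neg_eq_comap (M a r₀ : ℝ) {R : Kerr.region (-a) r₀ → Kerr.region a r₀}
    (hR : ∀ x, (R x : E4) = L x) (hRc : ContMDiff 𝓘(ℝ, E4) 𝓘(ℝ, E4) (∞ + 1) R)
    (hRi : ∀ x, Injective (mfderiv 𝓘(ℝ, E4) 𝓘(ℝ, E4) R x)) (hdim : Module.finrank ℝ E4 = Module.finrank ℝ E4) :
    (Kerr.smoothMetric M (-a) r₀).toPseudoRiemannianMetric =
      (Kerr.smoothMetric M a r₀).toPseudoRiemannianMetric.comap
        PseudoRiemannianMetric.contMDiff_pullbackBilin_holds R hRc hRi hdim := by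
  refine PseudoRiemannianMetric.ext (funext fun x ↦
    ContinuousLinearMap.ext fun v ↦ ContinuousLinearMap.ext fun w ↦ ?_)
  rw [PseudoRiemannianMetric.val_comap, pullbackBilin_apply, mfderiv_isom_apply hR, mfderiv_isom_apply hR]
  change Kerr.bilin M (-a) x v w = Kerr.bilin M a (R x : E4) (L v) (L w)
  rw [hR, bilin_reflect hL]

variable [Kerr.SliceFacts] {M a b r₀ : ℝ} {F : Kerr.slice b r₀ ≃ₜ Kerr.slice a r₀}
  (hF : ∀ y, ((F y : Kerr.slice a r₀) : E3) = L₃ y)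
include hL₃ hF

/-- **Spin reversal and the second fundamental form of the slice**: `k_{M,−a}(y)(v, w) = k_{M,a}(F y)(L₃ v, L₃ w)`.
The slice data are `K_{ι,ν}` for the slice embedding `ι(y) = (0, y)` and the future unit normal `ν` in
`(Kerr.region, g_{M,·})`; since `g_{M,−a} = L^* g_{M,a}` (`smoothMetric_neg_eq_comap`), naturality of the second
fundamental form under the local isometry `L` (`secondFundamentalForm_comap`: `K^{L^*g}_{ι,ν} = K^{g}_{L ∘ ι, dL ν}`),
the identities `L ∘ ι_{−a} = ι_a ∘ F`, `L ν_{M,−a} = ν_{M,a} ∘ F` (`ofTimeSpace_reflect₃`, `reflect_sliceNormal`) and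
reparametrisation invariance (`secondFundamentalForm_comp_right`: `K_{ι ∘ F, ν ∘ F}(y)(v, w) = K_{ι,ν}(F y)(dF v, dF w)`)
give the claim.  O'Neill 1983, Ch. 3, Prop. 3.59 and Ch. 4, Lemma 4.4; Cook 2000, §3.2.2.
[cite: ONeill1983, Ch. 3, Prop. 3.59 and Ch. 4, Lemma 4.4] -/
theorem sliceK_reflect (hba : b = -a) (hM : 0 ≤ M) (y : Kerr.slice b r₀) (v w : E3) :
    Kerr.sliceK M b r₀ y v w = Kerr.sliceK M a r₀ (F y) (L₃ v) (L₃ w) := by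
  subst hba
  -- the chart reflection `R : Kerr.region (−a) r₀ → Kerr.region a r₀`
  let R : Kerr.region (-a) r₀ → Kerr.region a r₀ := fun x ↦ ⟨L (x : E4), (reflect_mem_region_iff hL).2 x.2⟩
  have hR : ∀ x, (R x : E4) = L (x : E4) := fun _ ↦ rfl
  have hRc : ContMDiff 𝓘(ℝ, E4) 𝓘(ℝ, E4) (∞ + 1) R := contMDiff_isom hR
  have hRi : ∀ x, Injective (mfderiv 𝓘(ℝ, E4) 𝓘(ℝ, E4) R x) := injective_mfderiv_isom hR
  have hdim : Module.finrank ℝ E4 = Module.finrank ℝ E4 := rfl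
  set gₐ : PseudoRiemannianMetric 𝓘(ℝ, E4) ∞ E4 (TangentSpace 𝓘(ℝ, E4) : Kerr.region a r₀ → Type _) :=
    (Kerr.smoothMetric M a r₀).toPseudoRiemannianMetric with hgₐ
  set gm : PseudoRiemannianMetric 𝓘(ℝ, E4) ∞ E4 (TangentSpace 𝓘(ℝ, E4) : Kerr.region (-a) r₀ → Type _) :=
    (Kerr.smoothMetric M (-a) r₀).toPseudoRiemannianMetric with hgm
  -- (1) the metric of spin `−a` is the pull-back of the metric of spin `a`
  have hmet : gm = gₐ.comap PseudoRiemannianMetric.contMDiff_pullbackBilin_holds R hRc hRi hdim :=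
    smoothMetric_neg_eq_comap hL M a r₀ hR hRc hRi hdim
  haveI i₁ : (gₐ.comap PseudoRiemannianMetric.contMDiff_pullbackBilin_holds R hRc hRi hdim).HasLeviCivita :=
    PseudoRiemannianMetric.hasLeviCivita _
  have h1 : gm.secondFundamentalForm 𝓘(ℝ, E3) (Kerr.sliceEmbed (-a) r₀) (Kerr.sliceNormal M (-a) r₀) y =
      (gₐ.comap PseudoRiemannianMetric.contMDiff_pullbackBilin_holds R hRc hRi hdim).secondFundamentalForm 𝓘(ℝ, E3)
        (Kerr.sliceEmbed (-a) r₀) (Kerr.sliceNormal M (-a) r₀) y :=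
    PseudoRiemannianMetric.secondFundamentalForm_congr_metric hmet inferInstance i₁ _ _ _
  -- (2) naturality under the local isometry `R`
  have hν : MDifferentiableAt 𝓘(ℝ, E3) 𝓘(ℝ, E4).tangent
      (fun y ↦ (TotalSpace.mk' E4 (Kerr.sliceEmbed (-a) r₀ y) (Kerr.sliceNormal M (-a) r₀ y) :
        TangentBundle 𝓘(ℝ, E4) (Kerr.region (-a) r₀))) y :=
    (Kerr.dataEmbedding M (-a) r₀ hM).mdifferentiableAt_embed_normal y
  have h2 := PseudoRiemannianMetric.secondFundamentalForm_comap gₐ PseudoRiemannianMetric.contMDiff_pullbackBilin_holds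
    hRc hRi hdim (I'' := 𝓘(ℝ, E3)) (f := Kerr.sliceEmbed (-a) r₀) (ν := Kerr.sliceNormal M (-a) r₀) (y := y)
    BoundarylessManifold.isInteriorPoint hν
  -- (3) `R ∘ ι₋ = ιₐ ∘ F` and `dR ν₋ = νₐ ∘ F`
  have hfF : R ∘ Kerr.sliceEmbed (-a) r₀ = Kerr.sliceEmbed a r₀ ∘ F := funext fun y' ↦ Subtype.ext (by
    show L (E4.ofTimeSpace 0 (y' : E3)) = E4.ofTimeSpace 0 ((F y' : Kerr.slice a r₀) : E3)
    rw [hF, ofTimeSpace_reflect₃ hL hL₃])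
  have hνF : ∀ y' : Kerr.slice (-a) r₀, mfderiv 𝓘(ℝ, E4) 𝓘(ℝ, E4) R (Kerr.sliceEmbed (-a) r₀ y')
      (Kerr.sliceNormal M (-a) r₀ y') = Kerr.sliceNormal M a r₀ (F y') := fun y' ↦ by
    rw [mfderiv_isom_apply hR]
    exact reflect_sliceNormal hL hL₃ M a r₀ y' (F y') (hF y')
  have h3 := secondFundamentalForm_congr_map' (g := gₐ) hfF
    (ν₁ := fun y' ↦ mfderiv 𝓘(ℝ, E4) 𝓘(ℝ, E4) R (Kerr.sliceEmbed (-a) r₀ y') (Kerr.sliceNormal M (-a) r₀ y'))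
    (ν₂ := fun y' ↦ Kerr.sliceNormal M a r₀ (F y')) hνF y
  -- (4) reparametrisation by `F`
  have hνₐ : MDifferentiableAt 𝓘(ℝ, E3) 𝓘(ℝ, E4).tangent
      (fun z ↦ (TotalSpace.mk' E4 (Kerr.sliceEmbed a r₀ z) (Kerr.sliceNormal M a r₀ z) :
        TangentBundle 𝓘(ℝ, E4) (Kerr.region a r₀))) (F y) :=
    (Kerr.dataEmbedding M a r₀ hM).mdifferentiableAt_embed_normal (F y)
  have hFd : MDifferentiableAt 𝓘(ℝ, E3) 𝓘(ℝ, E3) F y := (contMDiff_isom hF (n := 1)).mdifferentiableAt one_ne_zero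
  have h4 := PseudoRiemannianMetric.secondFundamentalForm_comp_right gₐ (f := Kerr.sliceEmbed a r₀)
    (ν := Kerr.sliceNormal M a r₀) (Ψ := F) (u := y) BoundarylessManifold.isInteriorPoint
    BoundarylessManifold.isInteriorPoint hνₐ hFd v w
  rw [mfderiv_isom_apply hF, mfderiv_isom_apply hF] at h4
  -- assemble
  rw [Kerr.sliceK_apply, Kerr.sliceK_apply]
  change gm.secondFundamentalForm 𝓘(ℝ, E3) (Kerr.sliceEmbed (-a) r₀) (Kerr.sliceNormal M (-a) r₀) y v w =
    gₐ.secondFundamentalForm 𝓘(ℝ, E3) (Kerr.sliceEmbed a r₀) (Kerr.sliceNormal M a r₀) (F y) (L₃ v) (L₃ w)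
  rw [h1, h2, h3]
  exact h4

/-- **The Kerr datum of spin `−a` is the pull-back of the Kerr datum of spin `a` along the reflection of the slice**:
`F^* (Kerr.data M a r₀) = Kerr.data M (−a) r₀` on `Kerr.slice (−a) r₀`.  The metrics agree because the slice
embeddings `ι(y) = (0, y)` correspond under `L` (`(0, L₃ y) = L (0, y)`, `d ι = (0, ·)`) and `g_{M,−a} = L^* g_{M,a}`
(`bilin_reflect`): `h_{M,a}(L₃ y)(L₃ v, L₃ w) = h_{M,−a}(y)(v, w)`; the second fundamental forms agree by
`sliceK_reflect`.  Bartnik–Isenberg 2004, §2; Kerr–Schild 1965, §2; Cook 2000, §3.2.2. [cite: BartnikIsenberg2004, §2] -/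
theorem comap_sliceReflect_kerrData (hba : b = -a) (hM : 0 ≤ M) (hFc : ContMDiff (𝓡 3) (𝓡 3) (∞ + 1) F)
    (hFi : ∀ u, Injective (mfderiv (𝓡 3) (𝓡 3) F u)) :
    (Kerr.data M a r₀ hM).comap F hFc hFi = Kerr.data M b r₀ hM := by
  subst hba
  refine InitialDataSet.ext' (fun y v w ↦ ?_) (fun y v w ↦ ?_)
  · rw [comap_h_inner_sliceReflect hF hFc hFi, Kerr.data_h_inner, Kerr.data_h_inner,
      PseudoRiemannianMetric.inducedBilin_apply, PseudoRiemannianMetric.inducedBilin_apply,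
      Kerr.mfderiv_sliceEmbed_apply, Kerr.mfderiv_sliceEmbed_apply, Kerr.mfderiv_sliceEmbed_apply,
      Kerr.mfderiv_sliceEmbed_apply, Kerr.smoothMetric_val, Kerr.smoothMetric_val, Kerr.coe_sliceEmbed,
      Kerr.coe_sliceEmbed, hF, ofTimeSpace_reflect₃ hL hL₃, ofTimeSpace_reflect₃ hL hL₃, ofTimeSpace_reflect₃ hL hL₃]
    exact (bilin_reflect hL M a _ _ _).symm
  · rw [comap_k_sliceReflect hF hFc hFi, Kerr.data_k, Kerr.data_k]
    exact (sliceK_reflect hL hL₃ hF rfl hM y v w).symm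

end KerrData

/-- **Registered sub-goal `stub_comap_sliceReflect_kerrData`** (crux item stmt-FinalStateConjecture-14985): for the
coordinate reflections `L` (`x₂ ↦ −x₂` on `ℝ⁴`) and `L₃` (`y₁ ↦ −y₁` on `ℝ³`) and any homeomorphism
`F : Kerr.slice b r₀ ≃ₜ Kerr.slice a r₀`, `b = −a`, given by `L₃` in coordinates, `F^* (Kerr.data M a r₀) = Kerr.data M b r₀`
(closed form of `comap_sliceReflect_kerrData`). [cite: BartnikIsenberg2004, §2] -/
theorem stub_comap_sliceReflect_kerrData : ∀ [Kerr.Facts] [Kerr.SliceFacts] (L : E4 ≃ₗᵢ[ℝ] E4), (∀ (x : E4) (i : Fin 4), L x i = if i = 2 then -x i else x i) → ∀ (L₃ : E3 ≃ₗᵢ[ℝ] E3), (∀ (y : E3) (i : Fin 3), L₃ y i = if i = 1 then -y i else y i) → ∀ (M a b r₀ : ℝ), b = -a → ∀ (hM : 0 ≤ M) (F : Kerr.slice b r₀ ≃ₜ Kerr.slice a r₀), (∀ y, ((F y : Kerr.slice a r₀) : E3) = L₃ y) → ∀ (hFc : ContMDiff (𝓡 3) (𝓡 3) (∞ + 1)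 F) (hFi : ∀ u, Function.Injective (mfderiv (𝓡 3) (𝓡 3) F u)), (Kerr.data M a r₀ hM).comap F hFc hFi = Kerr.data M b r₀ hM :=
  fun _ hL _ hL₃ _ _ _ _ hba hM _ hF hFc hFi ↦ comap_sliceReflect_kerrData hL hL₃ hF hba hM hFc hFi

end Summit.FinalStateConjecture.FinalStateConjecture.Theorems.BulkKerrCaptureC2.Reflection

end
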